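import Mathlib
import Literature.Computability.AlgebraicComplexity.PermanentIrreducible
import Summits.ValiantsHypothesis.ValiantsHypothesis.Theses.DivisionGap

/-!
# Route `DivisionGap` — assembly (item stmt-ValiantsHypothesis-5074)

`Assembly := PerDivisionHard → ZeroOneTransfer → PerNotVPToVH → ValiantsHypothesis`.

Pure bookkeeping.  Assume H1 (`PerDivisionHard`: for every `c`, eventually every nonzero
`h ∈ ℝ≥0[x_ij]` has `L₊(per_n · h) + L₊(h) > 2^((log₂ n + c)^c)`), H2 (`ZeroOneTransfer`: every
0/1-coefficient family over `ℝ≥0` whose complexification is a `VP_ℂ` family has division complexity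
`≤ 2^((log₂ n + c)^c)` for one `c` and all `n`) and the glue `PerNotVPToVH`
(`¬ IsVPFamily_ℂ per → ValiantsHypothesis`).  It then suffices to refute `IsVPFamily_ℂ per`:
the permanent over `ℝ≥0` has coefficients in `{0, 1}` (its support consists of the permutation
monomials, each with coefficient `1`:
`Literature.Computability.AlgebraicComplexity.coeff_permMonomial_perPoly`,
`…exists_permMonomial_eq_of_coeff_perPoly_ne_zero`) and complexifies to the permanent over `ℂ`
(`…map_perPoly`), so H2 yields `c` with division complexity `≤ 2^((log₂ n + c)^c)` for ALL `n`,
while H1 at this `c` yields an `n` at which it is larger.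

As observed in the route review, only the weak form "for every `c` there is SOME `n` beating the
bound" of H1 is used (together with H2 it already gives `per ∉ VP_ℂ`); we record this as
`not_isVPFamily_per_of_perDivisionHard_exists` and derive the item from it.
-/

-- `Summit.ValiantsHypothesis.ValiantsHypothesis.…` is the tree's mandated single-conjunct layout
-- (Sub = Summit), so the duplicated namespace component is intended.
set_option linter.dupNamespace false

namespace Summit.ValiantsHypothesis.ValiantsHypothesis.Theorems.DivisionGap

open Literature.Computability.AlgebraicComplexity
open Summit.ValiantsHypothesis.ValiantsHypothesis.Theses.DivisionGap

/-- The permanent over `ℝ≥0` has all coefficients in `{0, 1}`: a nonzero coefficient sits on a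
permutation monomial, whose coefficient is `1` (permutation monomials of distinct permutations are
distinct). [folklore] -/
theorem coeff_perPoly_nnreal_eq_zero_or_eq_one (n : ℕ) (m : (Fin n × Fin n) →₀ ℕ) :
    MvPolynomial.coeff m (perPoly (Fin n) NNReal) = 0 ∨
      MvPolynomial.coeff m (perPoly (Fin n) NNReal) = 1 := by
  by_cases h : MvPolynomial.coeff m (perPoly (Fin n) NNReal) = 0
  · exact Or.inl h
  · obtain ⟨ρ, rfl⟩ := exists_permMonomial_eq_of_coeff_perPoly_ne_zero NNReal h
    exact Or.inr (coeff_permMonomial_perPoly NNReal ρ)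

/-- The complexification of the permanent family over `ℝ≥0` is the permanent family over `ℂ`
(`map_perPoly`, stated for the family as a function of `n`). [folklore] -/
theorem map_perPoly_nnreal_family :
    (fun n => MvPolynomial.map (Complex.ofRealHom.comp NNReal.toRealHom) (perPoly (Fin n) NNReal)) =
      fun n => perPoly (Fin n) ℂ := by
  funext n
  exact map_perPoly _

/-- **`per ∉ VP_ℂ` from the weak form of H1 and the transfer H2.** If for every `c` there is
SOME `n` at which every nonzero `h ∈ ℝ≥0[x_ij]` has `L₊(per_n · h) + L₊(h) > 2^((log₂ n + c)^c)`,
then `ZeroOneTransfer` forces `per ∉ VP_ℂ`: were `per` a `VP_ℂ` family, the transfer (applied to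
`per` over `ℝ≥0`, which has 0/1 coefficients and complexifies to `per` over `ℂ`) would bound its
division complexity by `2^((log₂ n + c)^c)` for one `c` and all `n`, contradicting the hypothesis
at that `c`. [folklore] -/
theorem not_isVPFamily_per_of_perDivisionHard_exists
    (h1 : ∀ c : ℕ, ∃ n : ℕ, ∀ h : MvPolynomial (Fin n × Fin n) NNReal, h ≠ 0 →
      2 ^ ((Nat.log 2 n + c) ^ c) < complexity (perPoly (Fin n) NNReal * h) + complexity h)
    (h2 : ZeroOneTransfer) : ¬ IsVPFamily (k := ℂ) (fun n => perPoly (Fin n) ℂ) := by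
  intro hVP
  have hVP' : IsVPFamily (k := ℂ)
      (fun n => MvPolynomial.map (Complex.ofRealHom.comp NNReal.toRealHom)
        (perPoly (Fin n) NNReal)) := by
    rw [map_perPoly_nnreal_family]; exact hVP
  obtain ⟨c, hc⟩ := h2 (fun n => Fin n × Fin n) (fun n => perPoly (Fin n) NNReal)
    coeff_perPoly_nnreal_eq_zero_or_eq_one hVP'
  obtain ⟨n, hn⟩ := h1 c
  obtain ⟨h, hne, hle⟩ := hc n
  exact absurd (hn h hne) (not_lt.mpr hle)

/-- **Settles item stmt-ValiantsHypothesis-5074** (assembly of route `DivisionGap`):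
`PerDivisionHard → ZeroOneTransfer → PerNotVPToVH → ValiantsHypothesis` — specialise H1 at
`n := n₀(c)`, get `per ∉ VP_ℂ` from `not_isVPFamily_per_of_perDivisionHard_exists`, and apply the
glue `PerNotVPToVH`. [folklore] -/
theorem assembly_proof :
    Summit.ValiantsHypothesis.ValiantsHypothesis.Theses.DivisionGap.Assembly := by
  unfold Summit.ValiantsHypothesis.ValiantsHypothesis.Theses.DivisionGap.Assembly
  intro h1 h2 h3
  refine h3 (not_isVPFamily_per_of_perDivisionHard_exists (fun c => ?_) h2)
  obtain ⟨n₀, hn₀⟩ := h1 c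
  exact ⟨n₀, hn₀ n₀ le_rfl⟩

end Summit.ValiantsHypothesis.ValiantsHypothesis.Theorems.DivisionGap
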